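import Summits.ABC.IUTFork.Joshi.Dictionary
import Summits.ABC.IUTFork.Joshi.TensorPacketsJoshiInd
import HarnessLib

/-!
# Dictionary row D-09 (tensor-packet codomain) — binding point: §9.4 carrier moves ⟹ `MovesAreInd`
# (block E of the abc-iut cell, rung LADDER-ABC:A2.E; one writer abc-iut-E-t20 per E-plan-2 07:13:52Z / E-PLAN R14)

BINDING-POINT file (E-PLAN R14: OUR frozen `Cor312*`/`Thm311*` decls are bound only in `Joshi/Dictionary*.lean` /
`Joshi/Test*.lean`). It composes E-plan's dictionary datum `Joshi.Dictionary S` (`Dictionary.lean`: `Move`, `real : Move →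
S.L.PacketAut`, candidate hypothesis `MovesAreInd` = the load-bearing half of Y1 `AnsatzWithinInd`, X-01) with slot T-20's
typing of [J-III] §9.4 (K. Joshi, arXiv:2401.13508 **v4** = `Joshi2024ATS3`; `TensorPacketsJoshi*.lean`): by §9.4 every move
Joshi lets act on the theta-values codomain `𝓘^ℚ_Mochizuki(L')` acts through isomorphisms of the local log-shell carriers
(Rmk. 9.4.8.2 p.105 l.53–56; Prop. 9.7.5.1 p.112 read summandwise), and under the strictification D-09 such a move IS the
packet-automorphism family `TensorPacketDatum.strictMove S.L g z` (`TensorPacketsJoshiInd.lean`, `rfl`). RESULT (kernel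
bookkeeping, no new hypothesis): a dictionary whose moves are REALISED as such strict carrier moves satisfies
`MovesAreInd` as soon as each move's local isomorphisms are uniformly `𝒟^⊢`-strip automorphisms (our (Ind1)) or
uniformly `Ism`-elements (our (Ind2)) — `movesAreInd_of_strictMoves`; with the other three X-01 hypotheses this yields Y1
(`ansatzWithinInd_of_strictMoves`, via E-plan's `ansatzWithinInd_of_moves`) and hence S (`pilotKummerIndRelated_of_strictMoves`,
via `pilotKummerIndRelated_of_ansatzWithinInd`). These are SUFFICIENT CONDITIONS; whether Joshi's actual moves (his Ind2 =
change of arithmeticoid, which RESCALES valuations — [J-I] §10, [J-IIp] Thm. 6.9.1; the collation isomorphisms = "all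
(topological) isomorphisms") are realised this way with `Ism`/strip-automorphism components at the REAL instantiation of
`LogShells` is the open question D-10 / Y1 (E-cx, E-ref; E-LOCATION §L1) — NOT settled here; at an instantiation whose
`ism` consists of isometries the hypothesis `hG` below is expected to be UNSATISFIABLE for rescaling moves (a location, not
a verdict). TAKES NO SIDE on [IUTchIII] Cor. 3.12, on Joshi's claims, or on Mochizuki's report on them; typed ≠ proved;
typed AS A CANDIDATE ≠ endorsed; the cell locates / conditionally verifies — NO abc claim.
-/

noncomputable section

namespace Summit.ABC.IUTFork.Joshi

open Thm311 Cor312 Cor312Vol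

variable {T : ThetaIndex} {S : LatticeSituation T} {P : Cor312.Setting S.toSituation}
  (ρ : (∀ v : T.V, v ∈ T.Vbad → Set (S.L.StarPacket v)) → ∀ (j : T.Label) (vQ : T.VQ), Set (S.L.Packet j vQ))
  (qK : ∀ v : T.V, v ∈ T.Vbad → Set (S.L.StarPacket v))

/-- **A dictionary REALISED BY STRICT CARRIER MOVES** (OUR READING of how [J-III] §9.4 lets moves act on
`𝓘^ℚ_Mochizuki(L')`, Rmk. 9.4.8.2 p.105 l.53–66 / (9.4.8.3), Prop. 9.7.5.1 p.112 summandwise): every move `g : 𝔇.Move` of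
E-plan's dictionary acts on the packets as the family `TensorPacketDatum.strictMove S.L (G g) (z g)` induced, under the
strictification D-09, by carrier automorphisms `G g y w : log(𝒟^⊢_w) ≃ log(𝒟^⊢_w)` along an `ℓ*+1`-tuple `z g` of
arithmeticoids. A `Prop` about the pair (dictionary, realisation data); candidate reading, never asserted. [folklore] -/
def RealisedByStrictMoves (𝔇 : Dictionary S) (𝔗 : TensorPacketDatum T)
    (G : 𝔇.Move → 𝔗.Arith → ∀ w : T.V, S.L.carrier w ≃ₗ[ℚ] S.L.carrier w) (z : 𝔇.Move → T.Label → 𝔗.Arith) : Prop :=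
  ∀ g : 𝔇.Move, 𝔇.real g = 𝔗.strictMove S.L (G g) (z g)

/-- **The local-isomorphism condition** (sufficient for OUR (Ind1)/(Ind2), `TensorPacketsJoshiInd.lean`): for every move,
its carrier automorphisms are ALL induced by `𝒟^⊢`-prime-strip isomorphisms (`LogShells.stripAut`, [IUTchIII] Prop. 1.2
(vi) functoriality — our (Ind1) with trivial capsule permutation) or ALL elements of `Ism` (`LogShells.ism`, Prop. 1.2
(vi)/(vii) — our (Ind2)). This is where row D-10 / Y1 lives: Joshi's Ind2 and collation isomorphisms rescale valuations,
`Ism` at the real instantiation is expected to consist of isometries (E-LOCATION §L1). Candidate hypothesis shape, never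
asserted. [folklore] -/
def LocalIsosInInd (𝔇 : Dictionary S) (𝔗 : TensorPacketDatum T)
    (G : 𝔇.Move → 𝔗.Arith → ∀ w : T.V, S.L.carrier w ≃ₗ[ℚ] S.L.carrier w) : Prop :=
  ∀ g : 𝔇.Move, (∀ (y : 𝔗.Arith) (w : T.V), G g y w ∈ S.L.stripAut w) ∨ ∀ (y : 𝔗.Arith) (w : T.V), G g y w ∈ S.L.ism w

/-- **D-09 binding: strict carrier moves with (Ind)-local components give `MovesAreInd`.** PROVED (from
`TensorPacketDatum.strictMove_mem_indClosure`). [folklore] -/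
theorem movesAreInd_of_strictMoves (𝔇 : Dictionary S) (𝔗 : TensorPacketDatum T)
    (G : 𝔇.Move → 𝔗.Arith → ∀ w : T.V, S.L.carrier w ≃ₗ[ℚ] S.L.carrier w) (z : 𝔇.Move → T.Label → 𝔗.Arith)
    (hR : RealisedByStrictMoves 𝔇 𝔗 G z) (hG : LocalIsosInInd 𝔇 𝔗 G) : MovesAreInd 𝔇 := by
  intro g
  rw [hR g]
  exact 𝔗.strictMove_mem_indClosure S.L (G g) (z g) (hG g)

/-- With the other three X-01 hypotheses of E-plan's dictionary (`BaseIsThetaPilot`, `DatumEquivariant`, `StdReachable`),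
strict carrier moves with (Ind)-local components yield Y1 = `AnsatzWithinInd` (E-plan's `ansatzWithinInd_of_moves`).
PROVED; every hypothesis displayed. [folklore] -/
theorem ansatzWithinInd_of_strictMoves (𝔇 : Dictionary S) (𝔗 : TensorPacketDatum T)
    (G : 𝔇.Move → 𝔗.Arith → ∀ w : T.V, S.L.carrier w ≃ₗ[ℚ] S.L.carrier w) (z : 𝔇.Move → T.Label → 𝔗.Arith)
    (hR : RealisedByStrictMoves 𝔇 𝔗 G z) (hG : LocalIsosInInd 𝔇 𝔗 G)
    (hB : BaseIsThetaPilot 𝔇 (P := P)) (hE : DatumEquivariant 𝔇) (hS : StdReachable 𝔇) :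
    AnsatzWithinInd ρ 𝔇 (P := P) :=
  ansatzWithinInd_of_moves ρ 𝔇 hB (movesAreInd_of_strictMoves 𝔇 𝔗 G z hR hG) hE hS

/-- … and, with Y2 (`StandardPointIsQPilot`, graded STRONGER-THAN-PRINT, E-PLAN R15), the residual sentence S =
`Cor312Vol.PilotKummerIndRelated` (E-plan's X-01 glue `pilotKummerIndRelated_of_ansatzWithinInd`). A FILLS-MODULO-(…)
shape whose open content is `hG` (row D-10) and `hQ` (R15); a LOCATION of the print ↔ S gap, never evidence toward S.
PROVED; every hypothesis displayed. [folklore] -/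
theorem pilotKummerIndRelated_of_strictMoves (𝔇 : Dictionary S) (𝔗 : TensorPacketDatum T)
    (G : 𝔇.Move → 𝔗.Arith → ∀ w : T.V, S.L.carrier w ≃ₗ[ℚ] S.L.carrier w) (z : 𝔇.Move → T.Label → 𝔗.Arith)
    (hR : RealisedByStrictMoves 𝔇 𝔗 G z) (hG : LocalIsosInInd 𝔇 𝔗 G)
    (hB : BaseIsThetaPilot 𝔇 (P := P)) (hE : DatumEquivariant 𝔇) (hS : StdReachable 𝔇)
    (hQ : StandardPointIsQPilot ρ qK 𝔇) :
    PilotKummerIndRelated S P ρ qK :=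
  pilotKummerIndRelated_of_ansatzWithinInd ρ qK 𝔇
    (ansatzWithinInd_of_strictMoves ρ 𝔇 𝔗 G z hR hG hB hE hS) hQ

end Summit.ABC.IUTFork.Joshi

end
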